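import Summits.CriticalPhenomena.CardyFormulaZ2.Theorems.CardyFlipRussoVoronoiHubFromSmirnovStubMeckeRussoPrelims

/-!
# Stub `stub_meckeRusso` (S1) of line `moebius-exact-delaunay-dilation-ward` — the one-point
# expansion of a Poisson functional under a finite perturbation of the intensity
# (crux `VoronoiHubFromSmirnov`, stmt-CriticalPhenomena-6433)

The derivative-free core of the Margulis–Russo / perturbation formula for Poisson processes
(Last–Penrose, *Lectures on the Poisson Process* (2017), Thm 19.1; Last 2014, Thm 3.2), over
the tree's PROVED Poisson calculus (Mecke equation `lintegral_tsum_eq_lintegral_lintegral_insert`,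
superposition `superposition_holds`, existence/uniqueness, void probability):

* `lintegral_countOne_eq`, `setIntegral_countOne_eq` — for a Poisson law `Pβ` with FINITE intensity
  `β` (`b = β(ℂ)`): `E[H(ξ); ξ has exactly one point] = e^{-b} ∫ H({z}) β(dz)` (Mecke at
  `f(ξ, a) = H(ξ) 1{N = 1}`: a.s. `ξ ∪ {a}` has one point iff `ξ = ∅`), and
  `Pβ{N = 1} = b e^{-b}` (`measureReal_countOne`);
* `finite_expansion` — for `H` measurable with values in `[0,1]`:
  `|E_{Pβ} H - H(∅) - ∫ (H({z}) - H(∅)) β(dz)| ≤ 3 b²` and `|E_{Pβ} H - H(∅)| ≤ b`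
  (split on `N ∈ {0, 1, ≥ 2}`, `P(N = 0) = e^{-b}`, `P(N ≥ 2) = 1 - e^{-b} - b e^{-b} ≤ b²`);
* `expansion_one` (registered `s1_expansionOne`) — for `P` Poisson(`κ`), `Q` Poisson(`κ + β`),
  `κ` σ-finite, `β` finite atomless, `F` measurable `[0,1]`-valued:
  `|E_Q F - E_P F - ∫ E_P[F(c ∪ {z}) - F(c)] β(dz)| ≤ 3 b²` and `|E_Q F - E_P F| ≤ b`
  (`Q = (P ⊗ Pβ) ∘ (∪)⁻¹` by superposition + uniqueness, Fubini, `finite_expansion` for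
  `H(ξ) = E_P F(c ∪ ξ)`).
-/

noncomputable section

namespace Summit.CriticalPhenomena.CardyFormulaZ2.Cruxes.VoronoiHubFromSmirnov.MoebiusExactDelaunayDilationWard

open scoped Topology ENNReal Interval
open Filter Set MeasureTheory
open Literature.Analysis.FunctionSpaces
open Literature.Probability.RandomPlanarGeometry

/-! ### Two elementary exponential bounds -/

/-- `0 ≤ e^{-b} - 1 + b ≤ b²` for `b ≥ 0`. [folklore] -/
theorem exp_neg_sub_one_add_mem {b : ℝ} (hb : 0 ≤ b) :
    0 ≤ Real.exp (-b) - 1 + b ∧ Real.exp (-b) - 1 + b ≤ b ^ 2 := by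
  have h1 : -b + 1 ≤ Real.exp (-b) := Real.add_one_le_exp (-b)
  have h2 : Real.exp (-b) * (1 + b) ≤ 1 := by
    have h3 : b + 1 ≤ Real.exp b := Real.add_one_le_exp b
    calc Real.exp (-b) * (1 + b) ≤ Real.exp (-b) * Real.exp b :=
          mul_le_mul_of_nonneg_left (by linarith) (Real.exp_pos _).le
      _ = 1 := by rw [← Real.exp_add]; simp
  refine ⟨by linarith, ?_⟩
  nlinarith [mul_nonneg hb (sub_nonneg.2 h1)]

/-- `0 ≤ 1 - e^{-b}(1 + b) ≤ b²` for `b ≥ 0` (the probability of at least two Poisson points).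
[folklore] -/
theorem one_sub_exp_neg_mul_mem {b : ℝ} (hb : 0 ≤ b) :
    0 ≤ 1 - Real.exp (-b) * (1 + b) ∧ 1 - Real.exp (-b) * (1 + b) ≤ b ^ 2 := by
  have h1 : -b + 1 ≤ Real.exp (-b) := Real.add_one_le_exp (-b)
  have h2 : Real.exp (-b) * (1 + b) ≤ 1 := by
    have h3 : b + 1 ≤ Real.exp b := Real.add_one_le_exp b
    calc Real.exp (-b) * (1 + b) ≤ Real.exp (-b) * Real.exp b :=
          mul_le_mul_of_nonneg_left (by linarith) (Real.exp_pos _).le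
      _ = 1 := by rw [← Real.exp_add]; simp
  refine ⟨by linarith, ?_⟩
  nlinarith [mul_le_mul_of_nonneg_right h1 (show (0:ℝ) ≤ 1 + b by linarith)]

/-! ### Integrals of `[0,1]`-valued functions -/

/-- A measurable `[0,1]`-valued function is integrable for a finite measure. [folklore] -/
theorem integrable_of_mem_Icc {α : Type*} [MeasurableSpace α] {μ : Measure α} [IsFiniteMeasure μ]
    {f : α → ℝ} (hfm : Measurable f) (hf : ∀ x, f x ∈ Icc (0:ℝ) 1) : Integrable f μ :=
  Integrable.of_bound hfm.aestronglyMeasurable 1 (Eventually.of_forall fun x => by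
    rw [Real.norm_eq_abs, abs_le]; exact ⟨by linarith [(hf x).1], (hf x).2⟩)

/-- The integral of a `[0,1]`-valued function against a finite measure lies in `[0, μ(univ)]`.
[folklore] -/
theorem integral_mem_Icc {α : Type*} [MeasurableSpace α] {μ : Measure α} [IsFiniteMeasure μ]
    {f : α → ℝ} (hfm : Measurable f) (hf : ∀ x, f x ∈ Icc (0:ℝ) 1) :
    0 ≤ ∫ x, f x ∂μ ∧ ∫ x, f x ∂μ ≤ μ.real univ := by
  refine ⟨integral_nonneg fun x => (hf x).1, ?_⟩
  calc ∫ x, f x ∂μ ≤ ∫ _, (1:ℝ) ∂μ :=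
        integral_mono (integrable_of_mem_Icc hfm hf) (integrable_const _) fun x => (hf x).2
    _ = μ.real univ := by rw [integral_const, smul_eq_mul, mul_one]

/-! ### A Poisson process with finite intensity: no point, one point, at least two points -/

section FinitePoisson

variable {β : Measure ℂ} [IsFiniteMeasure β] {Pβ : Measure (PointConfig ℂ)}

/-- Count events `{N(ℂ) = k}` are measurable. [folklore] -/
theorem measurableSet_count_univ_eq (k : ℕ∞) :
    MeasurableSet {ξ : PointConfig ℂ | ξ.count univ = k} :=
  PointConfig.measurable_count MeasurableSet.univ (measurableSet_singleton k)

/-- Inserting a point `a ∉ ξ` raises the total count by one. [folklore] -/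
theorem count_univ_insertAt {a : ℂ} {ξ : PointConfig ℂ} (ha : a ∉ ξ) :
    (insertAt a ξ).count univ = ξ.count univ + 1 := by
  classical
  rw [insertAt_eq, PointConfig.count_union_ofFn_one, if_pos ⟨mem_univ a, ha⟩]

/-- **One-point term of the Mecke equation.** For a Poisson law `Pβ` with finite intensity `β`
and measurable `H ≥ 0`: `E[H(ξ); N = 1] = (∫ H({z}) β(dz)) · P(N = 0)` — the Mecke equation
(Last–Penrose 2017 Thm 4.1, tree `lintegral_tsum_eq_lintegral_lintegral_insert`) at
`f(ξ, a) = H(ξ) 1{N(ξ) = 1}`, where a.s. `ξ ∪ {a}` has exactly one point iff `ξ = ∅`.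
[cite: LastPenrose2017, Thm 4.1] -/
theorem lintegral_countOne_eq (hβ : IsPoissonPointProcess β Pβ) {H : PointConfig ℂ → ℝ}
    (hHm : Measurable H) :
    ∫⁻ ξ, {ξ : PointConfig ℂ | ξ.count univ = 1}.indicator (fun ξ => ENNReal.ofReal (H ξ)) ξ ∂Pβ
      = (∫⁻ z, ENNReal.ofReal (H (insertAt z ∅)) ∂β) * Pβ {ξ | ξ.count univ = 0} := by
  classical
  haveI := hβ.isProbabilityMeasure
  set A1 := {ξ : PointConfig ℂ | ξ.count univ = 1} with hA1
  set A0 := {ξ : PointConfig ℂ | ξ.count univ = 0} with hA0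
  have hA1m : MeasurableSet A1 := measurableSet_count_univ_eq 1
  have hA0m : MeasurableSet A0 := measurableSet_count_univ_eq 0
  set g : PointConfig ℂ → ℝ≥0∞ := A1.indicator fun ξ => ENNReal.ofReal (H ξ) with hg
  have hgm : Measurable g := (ENNReal.measurable_ofReal.comp hHm).indicator hA1m
  have hMecke := hβ.lintegral_tsum_eq_lintegral_lintegral_insert
    (f := fun p : PointConfig ℂ × ℂ => g p.1) (hgm.comp measurable_fst)
  -- left-hand side: the sum over the points of `ξ` of `g ξ` is `g ξ`
  have hL : ∀ ξ : PointConfig ℂ, (∑' _ : (ξ : Set ℂ), g ξ) = g ξ := by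
    intro ξ
    rw [ENNReal.tsum_set_const]
    by_cases h1 : ξ ∈ A1
    · have h1' : ξ.count univ = 1 := h1
      have : (ξ : Set ℂ).encard = 1 := by
        simpa [PointConfig.count] using h1'
      rw [this]
      simp
    · simp [hg, h1]
  simp_rw [hL] at hMecke
  rw [hMecke]
  -- right-hand side: a.s. `ξ ∪ {a}` has one point iff `ξ = ∅`
  have hR : ∀ a : ℂ, ∫⁻ ξ, g (ξ ∪ PointConfig.ofFn fun _ : Fin 1 => a) ∂Pβ
      = ENNReal.ofReal (H (insertAt a ∅)) * Pβ A0 := by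
    intro a
    have hae : ∀ᵐ ξ ∂Pβ, a ∉ ξ := by
      have h0 := hβ.measure_setOf_mem_eq_zero (measurableSet_singleton a)
      rw [ae_iff]
      simpa using h0
    rw [← lintegral_indicator_const hA0m]
    refine lintegral_congr_ae (hae.mono fun ξ hξ => ?_)
    show g (ξ ∪ PointConfig.ofFn fun _ : Fin 1 => a) = _
    rw [← insertAt_eq]
    by_cases h0 : ξ ∈ A0
    · have hξ0 : ξ = ∅ := eq_empty_of_count_univ h0
      have hmem : insertAt a ξ ∈ A1 := by
        show (insertAt a ξ).count univ = 1
        rw [count_univ_insertAt hξ, show ξ.count univ = 0 from h0, zero_add]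
      rw [indicator_of_mem h0, hg, indicator_of_mem hmem, hξ0]
    · have hnmem : insertAt a ξ ∉ A1 := by
        intro h1
        have h1' : (insertAt a ξ).count univ = 1 := h1
        rw [count_univ_insertAt hξ] at h1'
        have hne : ξ.count univ ≠ 0 := h0
        have hle : (1 : ℕ∞) + 1 ≤ 1 := by
          calc (1 : ℕ∞) + 1 ≤ ξ.count univ + 1 :=
                add_le_add_left (Order.one_le_iff_ne_zero.2 hne) 1
            _ = 1 := h1'
        exact absurd hle (by decide)
      rw [indicator_of_notMem h0, hg, indicator_of_notMem hnmem]
  simp_rw [hR]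
  rw [lintegral_mul_const (f := fun z => ENNReal.ofReal (H (insertAt z ∅))) _
    (ENNReal.measurable_ofReal.comp (hHm.comp (measurable_insertAt_left ∅)))]

/-- Real form of the one-point term for `[0,1]`-valued `H`:
`E[H(ξ); N = 1] = e^{-b} ∫ H({z}) β(dz)`, `b = β(ℂ)`. [cite: LastPenrose2017, Thm 4.1] -/
theorem setIntegral_countOne_eq (hβ : IsPoissonPointProcess β Pβ) {H : PointConfig ℂ → ℝ}
    (hHm : Measurable H) (hH : ∀ ξ, H ξ ∈ Icc (0:ℝ) 1) :
    ∫ ξ in {ξ : PointConfig ℂ | ξ.count univ = 1}, H ξ ∂Pβ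
      = Real.exp (-(β.real univ)) * ∫ z, H (insertAt z ∅) ∂β := by
  haveI := hβ.isProbabilityMeasure
  have hA1m : MeasurableSet {ξ : PointConfig ℂ | ξ.count univ = 1} := measurableSet_count_univ_eq 1
  have e0 : Pβ {ξ | ξ.count univ = 0} = ENNReal.ofReal (Real.exp (-(β.real univ))) :=
    hβ.measure_count_eq_zero MeasurableSet.univ (measure_ne_top β _)
  rw [integral_eq_lintegral_of_nonneg_ae (Eventually.of_forall fun ξ => (hH ξ).1)
      hHm.aestronglyMeasurable.restrict, ← lintegral_indicator hA1m,
    show (fun ξ => {ξ : PointConfig ℂ | ξ.count univ = 1}.indicator (fun ξ => ENNReal.ofReal (H ξ)) ξ)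
      = {ξ : PointConfig ℂ | ξ.count univ = 1}.indicator (fun ξ => ENNReal.ofReal (H ξ)) from rfl,
    lintegral_countOne_eq hβ hHm, e0, ENNReal.toReal_mul, ENNReal.toReal_ofReal (Real.exp_nonneg _),
    integral_eq_lintegral_of_nonneg_ae (Eventually.of_forall fun z => (hH _).1)
      (hHm.comp (measurable_insertAt_left ∅)).aestronglyMeasurable, mul_comm]

/-- `P(N = 1) = b e^{-b}` for a Poisson law with finite intensity of total mass `b`.
[cite: LastPenrose2017, Thm 4.1] -/
theorem measureReal_countOne (hβ : IsPoissonPointProcess β Pβ) :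
    Pβ.real {ξ : PointConfig ℂ | ξ.count univ = 1} = Real.exp (-(β.real univ)) * β.real univ := by
  have h := setIntegral_countOne_eq hβ (H := fun _ => (1:ℝ)) measurable_const
    (fun _ => ⟨zero_le_one, le_rfl⟩)
  rw [setIntegral_const, integral_const, smul_eq_mul, smul_eq_mul, mul_one, mul_one] at h
  exact h

/-- **Expansion of a Poisson functional with finite intensity** (Last–Penrose 2017, proof of
Thm 19.1 in the finite case): for `H` measurable with values in `[0,1]` and `b = β(ℂ)`,
`|E H - H(∅) - ∫ (H({z}) - H(∅)) β(dz)| ≤ 3 b²` and `|E H - H(∅)| ≤ b`: split the expectation on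
`N = 0` (probability `e^{-b}`, where `H = H(∅)`), `N = 1` (the one-point Mecke term
`e^{-b} ∫ H({z}) dβ`) and `N ≥ 2` (probability `1 - e^{-b} - b e^{-b} ≤ b²`).
[cite: LastPenrose2017, Thm 19.1] -/
theorem finite_expansion (hβ : IsPoissonPointProcess β Pβ) {H : PointConfig ℂ → ℝ}
    (hHm : Measurable H) (hH : ∀ ξ, H ξ ∈ Icc (0:ℝ) 1) :
    |∫ ξ, H ξ ∂Pβ - H ∅ - ∫ z, (H (insertAt z ∅) - H ∅) ∂β| ≤ 3 * β.real univ ^ 2 ∧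
      |∫ ξ, H ξ ∂Pβ - H ∅| ≤ β.real univ := by
  haveI := hβ.isProbabilityMeasure
  set b := β.real univ with hb_def
  have hb : 0 ≤ b := measureReal_nonneg
  set A0 := {ξ : PointConfig ℂ | ξ.count univ = 0} with hA0
  set A1 := {ξ : PointConfig ℂ | ξ.count univ = 1} with hA1
  have hA0m : MeasurableSet A0 := measurableSet_count_univ_eq 0
  have hA1m : MeasurableSet A1 := measurableSet_count_univ_eq 1
  have hdisj : Disjoint A0 A1 := by
    rw [Set.disjoint_left]
    intro ξ h0 h1
    have h0' : ξ.count univ = 0 := h0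
    have h1' : ξ.count univ = 1 := h1
    rw [h0'] at h1'
    exact zero_ne_one h1'
  have e0 : Pβ.real A0 = Real.exp (-b) :=
    hβ.measureReal_count_eq_zero MeasurableSet.univ (measure_ne_top β _)
  have e1 : Pβ.real A1 = Real.exp (-b) * b := measureReal_countOne hβ
  have hHi : Integrable H Pβ := integrable_of_mem_Icc hHm hH
  -- the three pieces
  set J := ∫ z, H (insertAt z ∅) ∂β with hJ_def
  have hJ : 0 ≤ J ∧ J ≤ b :=
    integral_mem_Icc (f := fun z => H (insertAt z ∅)) (hHm.comp (measurable_insertAt_left ∅)) fun z => hH _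
  set Rem := ∫ ξ in (A0 ∪ A1)ᶜ, H ξ ∂Pβ with hRem_def
  have hRem0 : 0 ≤ Rem := setIntegral_nonneg (hA0m.union hA1m).compl fun ξ _ => (hH ξ).1
  have hRem1 : Rem ≤ b ^ 2 := by
    have h1 : ‖Rem‖ ≤ 1 * Pβ.real (A0 ∪ A1)ᶜ :=
      norm_setIntegral_le_of_norm_le_const (measure_lt_top _ _) fun ξ _ => by
        rw [Real.norm_eq_abs, abs_le]; exact ⟨by linarith [(hH ξ).1], (hH ξ).2⟩
    rw [Real.norm_eq_abs, abs_of_nonneg hRem0, one_mul, measureReal_compl (hA0m.union hA1m),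
      probReal_univ, measureReal_union hdisj hA1m, e0, e1] at h1
    have := (one_sub_exp_neg_mul_mem hb).2
    linarith
  have hdecomp : ∫ ξ, H ξ ∂Pβ = Real.exp (-b) * H ∅ + Real.exp (-b) * J + Rem := by
    rw [← integral_add_compl (hA0m.union hA1m) hHi, setIntegral_union hdisj hA1m hHi.integrableOn
      hHi.integrableOn, setIntegral_congr_fun hA0m (g := fun _ => H ∅)
      (fun ξ hξ => by simp only; rw [eq_empty_of_count_univ hξ]), setIntegral_const, smul_eq_mul, e0,
      setIntegral_countOne_eq hβ hHm hH]
  have hlin : ∫ z, (H (insertAt z ∅) - H ∅) ∂β = J - b * H ∅ := by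
    rw [integral_sub (integrable_of_mem_Icc (f := fun z => H (insertAt z ∅))
      (hHm.comp (measurable_insertAt_left ∅)) fun z => hH _) (integrable_const _), integral_const,
      smul_eq_mul]
  have hexp := exp_neg_sub_one_add_mem hb
  have h1e : 0 ≤ 1 - Real.exp (-b) ∧ 1 - Real.exp (-b) ≤ b := by
    have := Real.add_one_le_exp (-b)
    exact ⟨by nlinarith [Real.exp_le_one_iff.2 (neg_nonpos.2 hb)], by linarith⟩
  have p1 : 0 ≤ H ∅ * (Real.exp (-b) - 1 + b) ∧ H ∅ * (Real.exp (-b) - 1 + b) ≤ b ^ 2 :=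
    ⟨mul_nonneg (hH ∅).1 hexp.1,
      (mul_le_mul_of_nonneg_left hexp.2 (hH ∅).1).trans (mul_le_of_le_one_left (sq_nonneg b) (hH ∅).2)⟩
  have p2 : 0 ≤ (1 - Real.exp (-b)) * J ∧ (1 - Real.exp (-b)) * J ≤ b * b :=
    ⟨mul_nonneg h1e.1 hJ.1, mul_le_mul h1e.2 hJ.2 hJ.1 hb⟩
  have p3 : Real.exp (-b) * J ≤ Real.exp (-b) * b :=
    mul_le_mul_of_nonneg_left hJ.2 (Real.exp_pos _).le
  have p4 : 0 ≤ Real.exp (-b) * J := mul_nonneg (Real.exp_pos _).le hJ.1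
  have p5 : H ∅ * (1 - Real.exp (-b)) ≤ 1 - Real.exp (-b) := mul_le_of_le_one_left h1e.1 (hH ∅).2
  have p6 : 0 ≤ H ∅ * (1 - Real.exp (-b)) := mul_nonneg (hH ∅).1 h1e.1
  have hRem2 : Rem ≤ 1 - Real.exp (-b) - Real.exp (-b) * b := by
    have h1 : ‖Rem‖ ≤ 1 * Pβ.real (A0 ∪ A1)ᶜ :=
      norm_setIntegral_le_of_norm_le_const (measure_lt_top _ _) fun ξ _ => by
        rw [Real.norm_eq_abs, abs_le]; exact ⟨by linarith [(hH ξ).1], (hH ξ).2⟩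
    rw [Real.norm_eq_abs, abs_of_nonneg hRem0, one_mul, measureReal_compl (hA0m.union hA1m),
      probReal_univ, measureReal_union hdisj hA1m, e0, e1] at h1
    linarith
  rw [hdecomp, hlin]
  constructor
  · rw [abs_le]
    constructor <;> nlinarith [p1.1, p1.2, p2.1, p2.2, hRem0, hRem1]
  · rw [abs_le]
    constructor <;> nlinarith [p3, p4, p5, p6, hRem0, hRem2, h1e.1, h1e.2]

end FinitePoisson

/-! ### One process: expansion under a finite perturbation of a σ-finite intensity -/

/-- **First-order expansion of a Poisson functional in the intensity** (Last–Penrose 2017,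
Thm 19.1 — integrated, derivative-free form with explicit second-order remainder). Let `P` be
Poisson with σ-finite intensity `κ`, `Q` Poisson with intensity `κ + β` where `β` is finite and
atomless (`b = β(ℂ)`), and `F` measurable with values in `[0,1]`. Then
`|E_Q F - E_P F - ∫ E_P[F(c ∪ {z}) - F(c)] β(dz)| ≤ 3 b²` and `|E_Q F - E_P F| ≤ b`.
Proof: `Q` is the superposition of `P` with an independent Poisson process `Pβ` of intensity
`β` (`superposition_holds`, `unique_holds`, existence `existsUnique_isPoissonPointProcess_holds`),
so `E_Q F = E_{Pβ} H` with `H(ξ) = E_P F(c ∪ ξ)` (Fubini), and `finite_expansion` applies to `H`.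
[cite: LastPenrose2017, Thm 19.1] -/
theorem s1_expansionOne : ∀ (κ β : Measure ℂ) [SigmaFinite κ], β univ ≠ ∞ → (∀ x, β {x} = 0) → ∀ (P Q : Measure (PointConfig ℂ)), IsPoissonPointProcess κ P → IsPoissonPointProcess (κ + β) Q → ∀ (F : PointConfig ℂ → ℝ), Measurable F → (∀ c, F c ∈ Icc (0:ℝ) 1) → |∫ c, F c ∂Q - ∫ c, F c ∂P - ∫ z, (∫ c, F (insertAt z c) ∂P - ∫ c, F c ∂P) ∂β| ≤ 3 * β.real univ ^ 2 ∧ |∫ c, F c ∂Q - ∫ c, F c ∂P| ≤ β.real univ := by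
  intro κ β _ hβfin hβ0 P Q hP hQ F hFm hF
  haveI : IsFiniteMeasure β := ⟨hβfin.lt_top⟩
  obtain ⟨Pβ, hPb⟩ := (existsUnique_isPoissonPointProcess_holds (E := ℂ) β hβ0).exists
  haveI := hP.isProbabilityMeasure
  haveI := hPb.isProbabilityMeasure
  have hsup := IsPoissonPointProcess.superposition_holds hP hPb
  have hQeq : Q = (P.prod Pβ).map (fun p => p.1 ∪ p.2) := IsPoissonPointProcess.unique_holds hQ hsup
  -- the averaged functional `H(ξ) = E_P F(c ∪ ξ)`
  set H : PointConfig ℂ → ℝ := fun ξ => ∫ c, F (c ∪ ξ) ∂P with hH_def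
  have hHm : Measurable H := by
    have hsm : StronglyMeasurable (Function.uncurry fun (c ξ : PointConfig ℂ) => F (c ∪ ξ)) :=
      (hFm.comp PointConfig.measurable_union').stronglyMeasurable
    exact (hsm.integral_prod_left (μ := P)).measurable
  have hH01 : ∀ ξ, H ξ ∈ Icc (0:ℝ) 1 := fun ξ => by
    have h := integral_mem_Icc (μ := P)
      (hFm.comp (PointConfig.measurable_union'.comp (measurable_id.prodMk measurable_const)))
      (fun c => hF (c ∪ ξ))
    rw [probReal_univ] at h
    exact h
  have key := finite_expansion hPb hHm hH01
  have h1 : ∫ c, F c ∂Q = ∫ ξ, H ξ ∂Pβ := by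
    rw [hQeq, integral_map PointConfig.measurable_union'.aemeasurable hFm.aestronglyMeasurable]
    exact integral_prod_symm (fun p : PointConfig ℂ × PointConfig ℂ => F (p.1 ∪ p.2))
      (integrable_of_mem_Icc (hFm.comp PointConfig.measurable_union') fun p => hF _)
  have h2 : ∫ c, F c ∂P = H ∅ := by simp [hH_def]
  have h3 : ∀ z, ∫ c, F (insertAt z c) ∂P = H (insertAt z ∅) := fun z => by simp [hH_def]
  rw [h1, h2]
  simp_rw [h3]
  exact key

/-- `expansion_one`, unpacked with instance and implicit arguments. [cite: LastPenrose2017, Thm 19.1] -/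
theorem expansion_one {κ β : Measure ℂ} [SigmaFinite κ] (hβfin : β univ ≠ ∞) (hβ0 : ∀ x, β {x} = 0)
    {P Q : Measure (PointConfig ℂ)} (hP : IsPoissonPointProcess κ P)
    (hQ : IsPoissonPointProcess (κ + β) Q) {F : PointConfig ℂ → ℝ} (hFm : Measurable F)
    (hF : ∀ c, F c ∈ Icc (0:ℝ) 1) :
    |∫ c, F c ∂Q - ∫ c, F c ∂P - ∫ z, (∫ c, F (insertAt z c) ∂P - ∫ c, F c ∂P) ∂β|
        ≤ 3 * β.real univ ^ 2 ∧ |∫ c, F c ∂Q - ∫ c, F c ∂P| ≤ β.real univ :=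
  s1_expansionOne κ β hβfin hβ0 P Q hP hQ F hFm hF

end Summit.CriticalPhenomena.CardyFormulaZ2.Cruxes.VoronoiHubFromSmirnov.MoebiusExactDelaunayDilationWard

end
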